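import Literature.Topology.FourManifolds.LefschetzBaseCover
import HarnessLib

/-!
# The standard Lefschetz base of genus `g`, XIII: the chain loops pushed to the base page `w = 1/2`

Topic `Literature/Topology/FourManifolds`; namespace `Literature.Topology.FourManifolds.LefschetzBase`.
The `A_{2g}` chain `chainLoop g i` (`LefschetzBasePages.lean`, §7) lives on the CENTRAL page
`y² = x^{2g+1} + 1` (`w = 0`, the interior of the base).  Kas' presentation of `H₁(∂X)` reads the
first homology of the base on the BOUNDARY page `page g 1 = {‖x‖² < 4, w = 1/2}` (the design's
base-page class map); this file transports the chain there:

* §17 the core `core g = {w = 0, ‖x‖ ≤ 1}` of the base (it contains the chain loops: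
  `coreChainLoop`, `map_coreChainLoop`) and the SCALING `(x, y) ↦ (c^{1/(2g+1)} x, √c · y)`,
  `c = 1 + t/2`, which carries the central page `y² = x^{2g+1} + 1` to the page `y² = x^{2g+1} + c`,
  `w = c − 1 = t/2`, inside the base (`coreScale`, `coreScaleHomotopy : incl|core ≃ pageIncl ∘ coreToPage`);
* **`pageChainLoop g i`** — the `i`-th chain loop scaled to the base page (`t = 1`), a loop IN
  `page g 1`, and **`map_loopClass_pageChainLoop`**: the inclusion `page g 1 ↪ Base g` sends its
  Hurewicz class to the class of `chainLoop g i` (homotopy invariance along `coreScaleHomotopy`);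
  hence a chain shadow reads `chainVec g i` on it (`shadow_pageChainLoop`).

With `Hₖ(page g 1) ≅ Hₖ(Base g)` (`LefschetzBasePageCover*.lean` and the Mayer–Vietoris comparison
downstream) the classes of the `pageChainLoop g i`, `i < 2g`, are a basis of `H₁(page g 1; ℤ)` read as
the chain vectors.  Everything here is PROVED; nothing is asserted.

## References
* J. Milnor, *Singular points of complex hypersurfaces*, Ann. of Math. Studies 61 (1968), §9,
  Thm. 9.1, Lemma 9.4. [Milnor1968]
* A. Hatcher, *Algebraic Topology*, CUP 2002, Thm. 2.10, §2.A (homotopy invariance, Hurewicz).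
  [HatcherAT2002]
-/

noncomputable section

open scoped Manifold ContDiff Topology
open Set Function Metric
open Literature.AlgebraicTopology.SingularHomology

namespace Literature.Topology.FourManifolds

/-- Local notation: `𝔼 n` is the model Euclidean space `EuclideanSpace ℝ (Fin n)`. -/
local notation "𝔼 " n:arg => EuclideanSpace ℝ (Fin n)

namespace LefschetzBase

universe v

variable {g : ℕ}

/-! ## §17 The core of the base and its scaling to the pages `w = t/2` -/

/-- **The core** `{w = 0, ‖x‖ ≤ 1}` of the base: the part of the central page over the unit disc,
which contains the `A_{2g}` chain. [cite: Milnor1968, §9] -/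
def core (g : ℕ) : Set (Base g) := {q | w g q.1 = 0 ∧ ‖cx q.1‖ ≤ 1}

/-- The scaling factor `c = 1 + t/2 ∈ [1, 3/2]` for `t ∈ [0, 1]`. [folklore] -/
theorem one_le_scale {t : ℝ} (ht0 : 0 ≤ t) : (1 : ℝ) ≤ 1 + t / 2 := by linarith

/-- **The scaling** `(x, y) ↦ ((1 + t/2)^{1/(2g+1)} x, √(1 + t/2) · y)` of the core, carrying the central
page to the page `y² = x^{2g+1} + 1 + t/2`. [folklore] -/
def coreScale (t : ℝ) (q : ↥(core g)) : 𝔼 4 :=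
  mk (((((1 + t / 2) ^ ((2 * g + 1 : ℕ) : ℝ)⁻¹ : ℝ)) : ℂ) * cx q.1.1) (((Real.sqrt (1 + t / 2) : ℝ) : ℂ) * cy q.1.1)

/-- Along the scaling `x^{2g+1}` is multiplied by `c`. [folklore] -/
theorem coreScale_xpow {t : ℝ} (ht0 : 0 ≤ t) (q : ↥(core g)) :
    (((((1 + t / 2) ^ ((2 * g + 1 : ℕ) : ℝ)⁻¹ : ℝ)) : ℂ) * cx q.1.1) ^ (2 * g + 1) =
      (((1 + t / 2 : ℝ)) : ℂ) * cx q.1.1 ^ (2 * g + 1) := by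
  rw [mul_pow, ← Complex.ofReal_pow, Real.rpow_inv_natCast_pow (by linarith) (Nat.succ_ne_zero _)]

/-- Along the scaling `w = t/2` (the core has `w = 0`). [folklore] -/
theorem w_coreScale {t : ℝ} (ht0 : 0 ≤ t) (q : ↥(core g)) : w g (coreScale t q) = (((t / 2 : ℝ)) : ℂ) := by
  have hw : cy q.1.1 ^ 2 - cx q.1.1 ^ (2 * g + 1) - 1 = 0 := q.2.1
  rw [coreScale, w_eq', cx_mk, cy_mk, coreScale_xpow ht0, mul_pow, ← Complex.ofReal_pow,
    Real.sq_sqrt (by linarith)]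
  have : cy q.1.1 ^ 2 = cx q.1.1 ^ (2 * g + 1) + 1 := by linear_combination hw
  rw [this]; push_cast; ring

/-- Along the scaling `‖x‖ ≤ 3/2` (`c^{1/(2g+1)} ≤ c ≤ 3/2` and `‖x‖ ≤ 1` on the core). [folklore] -/
theorem norm_cx_coreScale_le {t : ℝ} (ht0 : 0 ≤ t) (ht1 : t ≤ 1) (q : ↥(core g)) :
    ‖cx (coreScale t q)‖ ≤ 3 / 2 := by
  have hx : ‖cx q.1.1‖ ≤ 1 := q.2.2
  have hc1 : (1 : ℝ) ≤ 1 + t / 2 := one_le_scale ht0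
  have hroot : (1 + t / 2) ^ ((2 * g + 1 : ℕ) : ℝ)⁻¹ ≤ 3 / 2 := by
    calc (1 + t / 2) ^ ((2 * g + 1 : ℕ) : ℝ)⁻¹ ≤ (1 + t / 2) ^ (1 : ℝ) :=
          Real.rpow_le_rpow_of_exponent_le hc1 (inv_le_one_of_one_le₀ (by exact_mod_cast Nat.succ_pos _))
      _ = 1 + t / 2 := Real.rpow_one _
      _ ≤ 3 / 2 := by linarith
  have hroot0 : 0 ≤ (1 + t / 2) ^ ((2 * g + 1 : ℕ) : ℝ)⁻¹ := Real.rpow_nonneg (by linarith) _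
  rw [coreScale, cx_mk, norm_mul, Complex.norm_real, Real.norm_eq_abs, abs_of_nonneg hroot0]
  nlinarith

/-- The scaling stays in the base (`rho = (t/2)² ≤ 1/4`, `eta = 0`). [folklore] -/
theorem coreScale_mem {t : ℝ} (ht0 : 0 ≤ t) (ht1 : t ≤ 1) (q : ↥(core g)) :
    coreScale t q ∈ rho g ⁻¹' Iic (1 / 4 : ℝ) := by
  have hx := norm_cx_coreScale_le ht0 ht1 q
  rw [mem_preimage, mem_Iic, rho, w_coreScale ht0, Complex.norm_real, Real.norm_eq_abs,
    abs_of_nonneg (by linarith), eta_of_le (by nlinarith [norm_nonneg (cx (coreScale t q))])]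
  nlinarith

/-- At `t = 1` the scaling lands in the base page `page g 1`. [folklore] -/
theorem coreScale_one_mem_page (q : ↥(core g)) :
    (⟨coreScale 1 q, coreScale_mem zero_le_one le_rfl q⟩ : Base g) ∈ page g 1 := by
  refine ⟨?_, ?_⟩
  · show ‖cx (coreScale 1 q)‖ ^ 2 < 4
    nlinarith [norm_cx_coreScale_le zero_le_one le_rfl q, norm_nonneg (cx (coreScale 1 q))]
  · show w g (coreScale 1 q) = 1 / 2
    rw [w_coreScale zero_le_one]; push_cast; ring

/-- At `t = 0` the scaling is the identity. [folklore] -/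
theorem coreScale_zero (q : ↥(core g)) : coreScale 0 q = q.1.1 := by
  rw [coreScale]
  simp only [zero_div, add_zero, Real.one_rpow, Real.sqrt_one, Complex.ofReal_one, one_mul]
  exact mk_cx_cy _

/-- **The scaled core in the base page**: `q ↦ ((3/2)^{1/(2g+1)} x, √(3/2) y)` as a map
`core g → page g 1`. [folklore] -/
def coreToPage (g : ℕ) : C(↥(core g), ↥(page g 1)) where
  toFun q := ⟨⟨coreScale 1 q, coreScale_mem zero_le_one le_rfl q⟩, coreScale_one_mem_page q⟩
  continuous_toFun := by
    refine Continuous.subtype_mk (Continuous.subtype_mk ?_ _) _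
    unfold coreScale
    have hq : Continuous fun q : ↥(core g) => q.1.1 := continuous_subtype_val.comp continuous_subtype_val
    exact continuous_mk.comp ((continuous_const.mul (contDiff_cx.continuous.comp hq)).prodMk
      (continuous_const.mul (contDiff_cy.continuous.comp hq)))

/-- **The scaling homotopy** in the base, from the inclusion of the core (`t = 0`) to the inclusion of
the page after `coreToPage` (`t = 1`). [folklore] -/
def coreScaleHomotopy (g : ℕ) : ContinuousMap.Homotopy
    (⟨Subtype.val, continuous_subtype_val⟩ : C(↥(core g), Base g))
    ((⟨Subtype.val, continuous_subtype_val⟩ : C(↥(page g 1), Base g)).comp (coreToPage g)) where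
  toFun z := ⟨coreScale z.1 z.2, coreScale_mem z.1.2.1 z.1.2.2 z.2⟩
  continuous_toFun := by
    refine Continuous.subtype_mk ?_ _
    unfold coreScale
    have hq : Continuous fun z : unitInterval × ↥(core g) => z.2.1.1 :=
      continuous_subtype_val.comp (continuous_subtype_val.comp continuous_snd)
    have ht : Continuous fun z : unitInterval × ↥(core g) => (1 + (z.1 : ℝ) / 2) := by fun_prop
    have hpos : ∀ z : unitInterval × ↥(core g), (1 + (z.1 : ℝ) / 2) ≠ 0 := fun z => by
      have := z.1.2.1; positivity
    have hr : Continuous fun z : unitInterval × ↥(core g) =>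
        ((((1 + (z.1 : ℝ) / 2) ^ ((2 * g + 1 : ℕ) : ℝ)⁻¹ : ℝ)) : ℂ) :=
      Complex.continuous_ofReal.comp (ht.rpow_const fun z => Or.inl (hpos z))
    have hs : Continuous fun z : unitInterval × ↥(core g) => ((Real.sqrt (1 + (z.1 : ℝ) / 2) : ℝ) : ℂ) :=
      Complex.continuous_ofReal.comp ht.sqrt
    exact continuous_mk.comp ((hr.mul (contDiff_cx.continuous.comp hq)).prodMk
      (hs.mul (contDiff_cy.continuous.comp hq)))
  map_zero_left q := by
    apply Subtype.ext
    show coreScale ((0 : unitInterval) : ℝ) q = q.1.1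
    exact coreScale_zero q
  map_one_left q := rfl

/-! ## The chain loops in the core and on the base page -/

/-- The lifts of the chords lie in the core (`w = 0`, `‖x‖ ≤ 1`). [folklore] -/
theorem chordLift_mem_core (g i : ℕ) {ε : ℂ} (hε : ε ^ 2 = 1) (s : unitInterval) :
    (chordPath g i ε hε s) ∈ core g := by
  refine ⟨?_, ?_⟩
  · show w g (chordLift g i ε s) = 0
    simp only [w, Phi, chordLift, cx_mk, cy_mk]
    rw [mul_pow, hε, csqrt_sq]; ring
  · show ‖cx (chordLift g i ε s)‖ ≤ 1
    simp only [chordLift, cx_mk]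
    exact norm_chordX_le g i s.2

/-- The branch point `(ζ_k, 0)` as a point of the core. [folklore] -/
def coreEnd (g k : ℕ) : ↥(core g) :=
  ⟨chordEnd g k, by
    refine ⟨?_, ?_⟩
    · show w g (mk (branchPt g k) 0) = 0
      simp [w, Phi, branchPt_pow]
    · show ‖cx (mk (branchPt g k) 0)‖ ≤ 1
      simp [norm_branchPt]⟩

/-- The lift of the `i`-th chord on the sheet `ε` as a path in the core. [cite: Milnor1968, §9] -/
def coreChordPath (g i : ℕ) (ε : ℂ) (hε : ε ^ 2 = 1) : Path (coreEnd g i) (coreEnd g (i + 1)) where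
  toFun s := ⟨chordPath g i ε hε s, chordLift_mem_core g i hε s⟩
  continuous_toFun := (chordPath g i ε hε).continuous.subtype_mk _
  source' := Subtype.ext (chordPath g i ε hε).source
  target' := Subtype.ext (chordPath g i ε hε).target

/-- **The `i`-th chain loop, in the core.** [cite: Milnor1968, §9] -/
def coreChainLoop (g i : ℕ) : Path (coreEnd g i) (coreEnd g i) :=
  (coreChordPath g i 1 (one_pow 2)).trans (coreChordPath g i (-1) (by norm_num)).symm

/-- The core chain loop is the chain loop. [folklore] -/
theorem map_coreChainLoop (g i : ℕ) : (coreChainLoop g i).map continuous_subtype_val = chainLoop g i := by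
  rw [coreChainLoop, Path.map_trans, ← Path.map_symm, chainLoop]
  rfl

/-- **The `i`-th chain loop on the base page** `page g 1`: the core chain loop scaled by
`coreToPage` (`(x, y) ↦ ((3/2)^{1/(2g+1)} x, √(3/2) y)`), a loop on the smooth fibre
`y² = x^{2g+1} + 3/2` through its branch points `(3/2)^{1/(2g+1)} ζ_i`, `(3/2)^{1/(2g+1)} ζ_{i+1}`.
[cite: Milnor1968, §9] -/
def pageChainLoop (g i : ℕ) : Path (coreToPage g (coreEnd g i)) (coreToPage g (coreEnd g i)) :=
  (coreChainLoop g i).map (coreToPage g).continuous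

/-- **The inclusion `page g 1 ↪ Base g` sends the class of the page chain loop to the class of the
chain loop** (homotopy invariance along the scaling `coreScaleHomotopy`, Hatcher Thm. 2.10, and
naturality of the Hurewicz class). [cite: HatcherAT2002, Thm. 2A.1] -/
theorem map_loopClass_pageChainLoop (R : Type v) [CommRing R] (M : Type v) [AddCommGroup M] [Module R M]
    (m : M) (g i : ℕ) :
    singularHomology.map R M (⟨Subtype.val, continuous_subtype_val⟩ : C(↥(page g 1), Base g)) 1
        (loopClass R M m (pageChainLoop g i)) = loopClass R M m (chainLoop g i) := by
  rw [map_loopClass, pageChainLoop, Path.map_map, ← map_coreChainLoop]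
  have h0 := map_loopClass R M m (coreChainLoop g i) (⟨Subtype.val, continuous_subtype_val⟩ : C(↥(core g), Base g))
  have h1 := map_loopClass R M m (coreChainLoop g i)
    ((⟨Subtype.val, continuous_subtype_val⟩ : C(↥(page g 1), Base g)).comp (coreToPage g))
  rw [singularHomology.map_eq_of_homotopic R M ⟨coreScaleHomotopy g⟩] at h0
  exact h1.symm.trans h0

/-- **A chain shadow reads the chain vector on the page chain loop**: for `σ` with
`IsChainShadow g σ` and `i < 2g`, `σ (incl_* [pageChainLoop g i]) = chainVec g i`.
[cite: Milnor1968, Thm. 9.1] -/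
theorem shadow_pageChainLoop {σ : singularHomology ℤ ℤ (Base g) 1 →ₗ[ℤ] (Fin g ⊕ Fin g → ℤ)}
    (hσ : IsChainShadow g σ) {i : ℕ} (hi : i < 2 * g) :
    σ (singularHomology.map ℤ ℤ (⟨Subtype.val, continuous_subtype_val⟩ : C(↥(page g 1), Base g)) 1
      (loopClass ℤ ℤ (1 : ℤ) (pageChainLoop g i))) = chainVec g i := by
  rw [map_loopClass_pageChainLoop]; exact hσ.2 i hi

end LefschetzBase

end Literature.Topology.FourManifolds
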